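import Summits.Ventures.HSemireg.ContractionSpanPointIdeal
import HarnessLib

/-!
# Venture HSemireg — the degree-one contraction span (`HT¹`-type operators `q ∧ -`, `ι_θ`) of a point-ideal class:
# `dim span{q ∧ x, ι_θ x} = 2n` for `x = a·1 + b·ω`, `dim V = 2n`, `dim L = n` (th-7's `r₁(n) = 2n`, FORMULA-N §N.3)

HONEST FRAMING. Pure linear algebra continuing `ContractionSpanAlgebra.lean` / `ContractionSpanPointIdeal.lean`
(seat p4 of the computation cell `pub-hsemireg`; the degree-`1` factor ranks `r₁` entering th-7's Künneth formula
`r(X × X′, ch(I_p ⊠ I_q)) = r₂·1 + r₁·r₁ + 1·r₂`, `theory/FORMULA-N-th7.md` §N.3). Nothing here is a claim about any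
variety and nothing here says that HC / HC_CM / HC_AV holds. Everything is PROVED; no named fact.

Contents: `ContractionSpan.span₁ L Θ x = span{q ∧ x, ι_θ x : q ∈ L, θ ∈ Θ}`; for `x = a·1 + b·ω` with `L ∧ ω = 0`
it is `ι(L) ⊔ span{ι_θ ω}` (`span₁_algebraMap_add_smul`); `dim ι(L) = dim L` (`finrank_vecBlock`); for a top form
`ω ≠ 0` and `Θ = L^⊥`, `dim span{ι_θ ω} = dim V - dim L` (`finrank_contractBlock₁`); hence `dim span₁ = 2n` for `dim V = 2n ≥ 4`,
`dim L = n` (`finrank_span₁_pointIdeal`). References: [BourbakiAlgebre1a3] Ch. III §7, §11 no. 9.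
-/

noncomputable section

open CliffordAlgebra (contractLeft)
open ExteriorAlgebra (ι)
open Module

namespace Summit.Ventures.HSemireg

namespace ContractionSpan

section Ring

variable {K : Type*} [CommRing K] {V : Type*} [AddCommGroup V] [Module K V]

/-- **The degree-one contraction span** of `x`: `span{q ∧ x, ι_θ x : q ∈ L, θ ∈ Θ}` (the `HT¹ = H¹(𝒪) ⊕ H⁰(T)`-type
operators). [cite: BourbakiAlgebre1a3, Ch. III §11 no. 9] -/
def span₁ (L : Set V) (Θ : Set (Module.Dual K V)) (x : ExteriorAlgebra K V) : Submodule K (ExteriorAlgebra K V) :=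
  Submodule.span K ({y | ∃ q ∈ L, y = ι K q * x} ∪ {y | ∃ θ ∈ Θ, y = contractLeft θ x})

/-- The vector block `span{ι q : q ∈ L}` (`= ι(L)`). [cite: BourbakiAlgebre1a3, Ch. III §7] -/
def vecBlock (L : Set V) : Submodule K (ExteriorAlgebra K V) :=
  Submodule.span K {y | ∃ q ∈ L, y = ι K q}

/-- The single-contraction block `span{ι_θ ω : θ ∈ Θ}`. [cite: BourbakiAlgebre1a3, Ch. III §11 no. 9] -/
def contractBlock₁ (Θ : Set (Module.Dual K V)) (ω : ExteriorAlgebra K V) : Submodule K (ExteriorAlgebra K V) :=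
  Submodule.span K {y | ∃ θ ∈ Θ, y = contractLeft θ ω}

/-- **Step (i) in degree one**: if `q ∧ ω = 0` for `q ∈ L`, then for units `a, b` the degree-one span of
`x = a·1 + b·ω` is `ι(L) ⊔ span{ι_θ ω}` (`q ∧ x = a·q`, `ι_θ x = b·ι_θ ω`).
[cite: BourbakiAlgebre1a3, Ch. III §11 no. 9] -/
theorem span₁_algebraMap_add_smul {L : Set V} {Θ : Set (Module.Dual K V)} {ω : ExteriorAlgebra K V}
    (hLω : ∀ q ∈ L, ι K q * ω = 0) {a b : K} (ha : IsUnit a) (hb : IsUnit b) :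
    span₁ L Θ (algebraMap K _ a + b • ω) = vecBlock L ⊔ contractBlock₁ Θ ω := by
  have hq : ∀ q ∈ L, ι K q * (algebraMap K _ a + b • ω) = a • ι K q := fun q hq => by
    rw [mul_add, mul_smul_comm, hLω q hq, smul_zero, add_zero, ← Algebra.commutes, ← Algebra.smul_def]
  have hθ : ∀ θ : Module.Dual K V, contractLeft θ (algebraMap K _ a + b • ω) = b • contractLeft θ ω := fun θ => by
    rw [map_add, CliffordAlgebra.contractLeft_algebraMap, zero_add, map_smul]
  apply le_antisymm
  · refine Submodule.span_le.mpr ?_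
    rintro y (⟨q, hqL, rfl⟩ | ⟨θ, hθΘ, rfl⟩)
    · rw [hq q hqL]
      exact Submodule.mem_sup_left (Submodule.smul_mem _ _ (Submodule.subset_span ⟨q, hqL, rfl⟩))
    · rw [hθ θ]
      exact Submodule.mem_sup_right (Submodule.smul_mem _ _ (Submodule.subset_span ⟨θ, hθΘ, rfl⟩))
  · obtain ⟨ua, rfl⟩ := ha
    obtain ⟨ub, rfl⟩ := hb
    refine sup_le (Submodule.span_le.mpr ?_) (Submodule.span_le.mpr ?_)
    · rintro y ⟨q, hqL, rfl⟩
      have h : ι K q * (algebraMap K _ (ua : K) + (ub : K) • ω) ∈ span₁ L Θ (algebraMap K _ ua + (ub : K) • ω) :=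
        Submodule.subset_span (Or.inl ⟨q, hqL, rfl⟩)
      rw [hq q hqL] at h
      have h' := Submodule.smul_mem _ (↑ua⁻¹ : K) h
      rwa [smul_smul, Units.inv_mul, one_smul] at h'
    · rintro y ⟨θ, hθΘ, rfl⟩
      have h : contractLeft θ (algebraMap K _ (ua : K) + (ub : K) • ω) ∈
          span₁ L Θ (algebraMap K _ ua + (ub : K) • ω) :=
        Submodule.subset_span (Or.inr ⟨θ, hθΘ, rfl⟩)
      rw [hθ θ] at h
      have h' := Submodule.smul_mem _ (↑ub⁻¹ : K) h
      rwa [smul_smul, Units.inv_mul, one_smul] at h'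

/-- The vector block lies in degree `1`. [cite: BourbakiAlgebre1a3, Ch. III §7] -/
theorem vecBlock_le (L : Set V) : vecBlock (K := K) L ≤ ⋀[K]^1 V :=
  Submodule.span_le.mpr (by
    rintro y ⟨q, -, rfl⟩
    rw [ExteriorAlgebra.exteriorPower, pow_one]
    exact LinearMap.mem_range_self _ q)

/-- The single-contraction block of `ω ∈ Λᵈ V` lies in degree `d - 1`.
[cite: BourbakiAlgebre1a3, Ch. III §11 no. 9] -/
theorem contractBlock₁_le (Θ : Set (Module.Dual K V)) {d : ℕ} {ω : ExteriorAlgebra K V} (hω : ω ∈ ⋀[K]^d V) :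
    contractBlock₁ Θ ω ≤ ⋀[K]^(d - 1) V :=
  Submodule.span_le.mpr (by
    rintro y ⟨θ, -, rfl⟩
    exact contractLeft_mem_exteriorPower θ hω)

end Ring

section Field

variable {K : Type*} [Field K] {V : Type*} [AddCommGroup V] [Module K V]

/-- **`dim ι(L) = dim L`** (`ι : V → Λ V` is injective). [cite: BourbakiAlgebre1a3, Ch. III §7 no. 1] -/
theorem finrank_vecBlock (L : Submodule K V) :
    Module.finrank K (vecBlock (K := K) (L : Set V)) = Module.finrank K L := by
  have h : vecBlock (K := K) (L : Set V) = L.map (ι K) := by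
    apply le_antisymm
    · exact Submodule.span_le.mpr (by rintro y ⟨q, hq, rfl⟩; exact ⟨q, hq, rfl⟩)
    · rintro y ⟨q, hq, rfl⟩; exact Submodule.subset_span ⟨q, hq, rfl⟩
  rw [h]
  exact (Submodule.equivMapOfInjective _
    (ExteriorAlgebra.ι_leftInverse (R := K) (M := V)).injective L).symm.finrank_eq

section ContractBlock₁

variable [FiniteDimensional K V] (L C : Submodule K V) (hLC : IsCompl L C)

/-- The family `z_j := ι_{θⱼ} ω` of single contractions by the coordinate forms of a complement.
[cite: BourbakiAlgebre1a3, Ch. III §11 no. 9] -/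
def contractSingle (ω : ExteriorAlgebra K V) (j : Fin (Module.finrank K C)) : ExteriorAlgebra K V :=
  contractLeft (coordForm L C hLC j) ω

/-- The single-contraction block (for `Θ = {θ : θ|_L = 0}`) is spanned by the `z_j`.
[cite: BourbakiAlgebre1a3, Ch. III §11 no. 9] -/
theorem contractBlock₁_eq_span_contractSingle (ω : ExteriorAlgebra K V) :
    contractBlock₁ {θ : Module.Dual K V | ∀ q ∈ L, θ q = 0} ω =
      Submodule.span K (Set.range (contractSingle L C hLC ω)) := by
  apply le_antisymm
  · refine Submodule.span_le.mpr ?_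
    rintro y ⟨θ, hθ, rfl⟩
    rw [eq_sum_coordForm L C hLC hθ, map_sum, LinearMap.sum_apply]
    refine Submodule.sum_mem _ fun j _ => ?_
    rw [map_smul, LinearMap.smul_apply]
    exact Submodule.smul_mem _ _ (Submodule.subset_span ⟨j, rfl⟩)
  · refine Submodule.span_le.mpr ?_
    rintro y ⟨j, rfl⟩
    exact Submodule.subset_span ⟨_, fun q hq => coordForm_apply_of_mem L C hLC _ hq, rfl⟩

/-- The test `k_i ∧ z_j = [i = j]·ω` for a top form `ω`. [cite: BourbakiAlgebre1a3, Ch. III §11 no. 9] -/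
theorem test_contractSingle {ω : ExteriorAlgebra K V} (hVω : ∀ v : V, ι K v * ω = 0)
    (i j : Fin (Module.finrank K C)) :
    ι K ((Module.finBasis K C i : C) : V) * contractSingle L C hLC ω j = (if j = i then (1 : K) else 0) • ω := by
  rw [contractSingle, ι_mul_contractLeft_of_mul_eq_zero _ (hVω _), coordForm_basis]

/-- The `z_j` are linearly independent for a top form `ω ≠ 0`. [cite: BourbakiAlgebre1a3, Ch. III §11 no. 9] -/
theorem linearIndependent_contractSingle {ω : ExteriorAlgebra K V} (hVω : ∀ v : V, ι K v * ω = 0)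
    (hω0 : ω ≠ 0) :
    LinearIndependent K (contractSingle L C hLC ω) := by
  classical
  rw [linearIndependent_iff']
  intro s g hg i hi
  have h := congrArg (fun z => ι K ((Module.finBasis K C i : C) : V) * z) hg
  simp only [Finset.mul_sum, mul_smul_comm, mul_zero, test_contractSingle L C hLC hVω, smul_ite, smul_zero,
    one_smul, ite_smul, zero_smul, Finset.sum_ite_eq', hi, if_true] at h
  exact (smul_eq_zero.mp h).resolve_right hω0

/-- **`dim span{ι_θ ω : θ|_L = 0} = dim C`** for a top form `ω ≠ 0` and a complement `C` of `L`.
[cite: BourbakiAlgebre1a3, Ch. III §11 no. 9] -/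
theorem finrank_contractBlock₁_of_isCompl (hLC : IsCompl L C) {ω : ExteriorAlgebra K V}
    (hVω : ∀ v : V, ι K v * ω = 0) (hω0 : ω ≠ 0) :
    Module.finrank K (contractBlock₁ {θ : Module.Dual K V | ∀ q ∈ L, θ q = 0} ω) = Module.finrank K C := by
  rw [contractBlock₁_eq_span_contractSingle L C hLC,
    finrank_span_eq_card (linearIndependent_contractSingle L C hLC hVω hω0), Fintype.card_fin]

end ContractBlock₁

/-- **`dim span{ι_θ ω : θ|_L = 0} = dim V - dim L`** for a top form `ω ≠ 0`.
[cite: BourbakiAlgebre1a3, Ch. III §11 no. 9] -/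
theorem finrank_contractBlock₁ [FiniteDimensional K V] (L : Submodule K V) {ω : ExteriorAlgebra K V}
    (hVω : ∀ v : V, ι K v * ω = 0) (hω0 : ω ≠ 0) :
    Module.finrank K (contractBlock₁ {θ : Module.Dual K V | ∀ q ∈ L, θ q = 0} ω) =
      Module.finrank K V - Module.finrank K L := by
  obtain ⟨C, hLC⟩ := L.exists_isCompl
  rw [finrank_contractBlock₁_of_isCompl L C hLC hVω hω0, ← Submodule.finrank_add_eq_of_isCompl hLC,
    Nat.add_sub_cancel_left]

/-- **`r₁(n) = 2n` (th-7, FORMULA-N §N.3, `k = 1` sibling of T_lin).** For `dim V = 2n` with `n ≥ 2`, `L` of dimension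
`n`, `Θ = {θ : θ|_L = 0}`, `ω ≠ 0` of top degree and `a, b ≠ 0`: `dim span{q ∧ x, ι_θ x} = 2n` for `x = a·1 + b·ω`
(the blocks `ι(L)` and `span{ι_θ ω}` sit in degrees `1 ≠ 2n - 1` and have dimension `n` each).
[cite: BourbakiAlgebre1a3, Ch. III §7 no. 8 and §11 no. 9] -/
theorem finrank_span₁_pointIdeal [FiniteDimensional K V] {n : ℕ} (hV : Module.finrank K V = 2 * n)
    (L : Submodule K V) (hL : Module.finrank K L = n) {ω : ExteriorAlgebra K V} (hω : ω ∈ ⋀[K]^(2 * n) V)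
    (hω0 : ω ≠ 0) {a b : K} (ha : a ≠ 0) (hb : b ≠ 0) (hn : 2 ≤ n) :
    Module.finrank K (span₁ (L : Set V) {θ : Module.Dual K V | ∀ q ∈ L, θ q = 0} (algebraMap K _ a + b • ω)) =
      2 * n := by
  have hVω : ∀ v : V, ι K v * ω = 0 := ι_mul_eq_zero_of_mem_top hV hω
  rw [span₁_algebraMap_add_smul (L := (L : Set V)) (Θ := {θ : Module.Dual K V | ∀ q ∈ L, θ q = 0})
    (fun q _ => hVω q) (Ne.isUnit ha) (Ne.isUnit hb)]
  have hW : vecBlock (K := K) (L : Set V) ≤ ⋀[K]^1 V := vecBlock_le _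
  have hC : contractBlock₁ {θ : Module.Dual K V | ∀ q ∈ L, θ q = 0} ω ≤ ⋀[K]^(2 * n - 1) V := contractBlock₁_le _ hω
  haveI : FiniteDimensional K (vecBlock (K := K) (L : Set V)) := Submodule.finiteDimensional_of_le hW
  haveI : FiniteDimensional K (contractBlock₁ {θ : Module.Dual K V | ∀ q ∈ L, θ q = 0} ω) :=
    Submodule.finiteDimensional_of_le hC
  have hdisj : vecBlock (K := K) (L : Set V) ⊓ contractBlock₁ {θ : Module.Dual K V | ∀ q ∈ L, θ q = 0} ω = ⊥ :=
    disjoint_iff.mp ((disjoint_exteriorPower (K := K) (V := V) (by omega : 1 ≠ 2 * n - 1)).mono hW hC)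
  have hsum := Submodule.finrank_sup_add_finrank_inf_eq (vecBlock (K := K) (L : Set V))
    (contractBlock₁ {θ : Module.Dual K V | ∀ q ∈ L, θ q = 0} ω)
  rw [hdisj, finrank_bot, add_zero, finrank_vecBlock, finrank_contractBlock₁ L hVω hω0, hV, hL] at hsum
  omega

end Field

end ContractionSpan

end Summit.Ventures.HSemireg

end
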